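import Mathlib.Algebra.BigOperators.Ring.Finset
import Mathlib.Algebra.Order.BigOperators.Group.Finset
import Mathlib.Tactic.Ring
import Mathlib.Tactic.NormNum
import Summits.CriticalPhenomena.PercolationContinuityZ3.Theorems.PercNearOneGluingNoHeavyLowerTailSahiPair43CheckPacked

/-!
# `NoHeavyLowerTail` (crux stmt-CriticalPhenomena-4575), Sahi programme: the cell `(4,3)` — **lane arithmetic** for the packed checker

Support file (Sahi cell `prim-sahi`, seat `prim-sahi-typer` gen 31; `--supports stmt-CriticalPhenomena-4575`).  Pure proofs plus one
bookkeeping definition (`ofLanes`); no `sorry`, standard axioms.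

A LANE VECTOR is `ofLanes nb f = Σ_{i<nb} f i · 2^{LW·i}` (`LW = 96`).  When every lane value is `< 2^LW` the lanes can be read back
(`testBit_ofLanes`, `laneOf_ofLanes`) and the big-integer operations used by `…SahiPair43CheckPacked` act lane by lane:
* `ofLanes_add`, `ofLanes_sub` (pointwise `g ≤ f`), `ofLanes_mul`, bitwise `ofLanes_and` / `ofLanes_or` / `ofLanes_xor`;
* `ones_eq` (`ones nb` is the all-ones lane vector), `extract_eq` (`(P >>> x) &&& ones nb` reads bit `x` of every lane);
* **`satsub_eq`**: with the guard bit at `GB = 90` and all lanes `< 2^GB`, `satsub` is lane-wise TRUNCATED SUBTRACTION, hence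
  **`lmin_eq`**: `lmin` is the lane-wise minimum.
These are the only facts about the packing that the soundness proof of the checker uses. [this work]
-/

namespace Summit.CriticalPhenomena.PercolationContinuityZ3.Theorems.SahiGridPattern.Pair43

open Finset
open scoped BigOperators

/-! ### Lane vectors -/

/-- The lane vector with lanes `f 0, …, f (nb-1)`: `Σ_{i<nb} f i · 2^{LW·i}`. [this work] -/
def ofLanes (nb : ℕ) (f : ℕ → ℕ) : ℕ := ∑ i ∈ range nb, f i * 2 ^ (LW * i)

/-- Unfolding one lane. [this work] -/
theorem ofLanes_succ (nb : ℕ) (f : ℕ → ℕ) : ofLanes (nb + 1) f = ofLanes nb f + f nb * 2 ^ (LW * nb) := by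
  unfold ofLanes; rw [Finset.sum_range_succ]

/-- `ofLanes 0 f = 0`. [this work] -/
theorem ofLanes_zero (f : ℕ → ℕ) : ofLanes 0 f = 0 := by unfold ofLanes; simp

/-- Lane vectors depend only on the lanes below `nb`. [this work] -/
theorem ofLanes_congr {nb : ℕ} {f g : ℕ → ℕ} (h : ∀ i < nb, f i = g i) : ofLanes nb f = ofLanes nb g :=
  Finset.sum_congr rfl fun i hi => by rw [h i (mem_range.1 hi)]

/-- A lane vector with lanes `< 2^LW` is `< 2^{LW·nb}`. [this work] -/
theorem ofLanes_lt {nb : ℕ} {f : ℕ → ℕ} (hf : ∀ i < nb, f i < 2 ^ LW) : ofLanes nb f < 2 ^ (LW * nb) := by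
  induction nb with
  | zero => rw [ofLanes_zero]; exact Nat.one_le_two_pow
  | succ n ih =>
    rw [ofLanes_succ]
    have h1 : ofLanes n f < 2 ^ (LW * n) := ih fun i hi => hf i (Nat.lt_succ_of_lt hi)
    have h2 : f n * 2 ^ (LW * n) ≤ (2 ^ LW - 1) * 2 ^ (LW * n) :=
      Nat.mul_le_mul_right _ (Nat.le_sub_one_of_lt (hf n (Nat.lt_succ_self n)))
    have h3 : (2 ^ LW - 1) * 2 ^ (LW * n) + 2 ^ (LW * n) = 2 ^ (LW * (n + 1)) := by
      rw [Nat.mul_succ, Nat.pow_add, Nat.sub_one_mul, Nat.sub_add_cancel (Nat.le_mul_of_pos_left _ Nat.one_le_two_pow), Nat.mul_comm]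
    omega

/-- **Reading a bit of a lane vector**: bit `LW·i + j` (`j < LW`) is bit `j` of lane `i`. [this work] -/
theorem testBit_ofLanes {nb : ℕ} {f : ℕ → ℕ} (hf : ∀ i < nb, f i < 2 ^ LW) (i j : ℕ) (hj : j < LW) :
    (ofLanes nb f).testBit (LW * i + j) = (decide (i < nb) && (f i).testBit j) := by
  induction nb generalizing i with
  | zero => rw [ofLanes_zero]; simp
  | succ n ih =>
    have hfn : ∀ k < n, f k < 2 ^ LW := fun k hk => hf k (Nat.lt_succ_of_lt hk)
    rw [ofLanes_succ, Nat.mul_comm (f n), Nat.add_comm, Nat.testBit_two_pow_mul_add (f n) (ofLanes_lt hfn)]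
    rcases Nat.lt_trichotomy i n with hlt | rfl | hgt
    · have : LW * i + j < LW * n := by
        have : LW * i + LW ≤ LW * n := by rw [← Nat.mul_succ]; exact Nat.mul_le_mul_left _ hlt
        omega
      rw [if_pos this, ih hfn]; simp [hlt, Nat.lt_succ_of_lt hlt]
    · have : ¬ LW * i + j < LW * i := by omega
      rw [if_neg this, Nat.add_sub_cancel_left]; simp
    · have h1 : ¬ LW * i + j < LW * n := by
        have : LW * n + LW ≤ LW * i := by rw [← Nat.mul_succ]; exact Nat.mul_le_mul_left _ hgt
        omega
      rw [if_neg h1]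
      have h2 : LW ≤ LW * i + j - LW * n := by
        have : LW * n + LW ≤ LW * i := by rw [← Nat.mul_succ]; exact Nat.mul_le_mul_left _ hgt
        omega
      have h3 : (f n).testBit (LW * i + j - LW * n) = false :=
        Nat.testBit_lt_two_pow (lt_of_lt_of_le (hf n (Nat.lt_succ_self n)) (Nat.pow_le_pow_right (by omega) h2))
      rw [h3]
      have : ¬ i < n + 1 := by omega
      simp [this]

/-- `0 < LW`. [this work] -/
theorem LW_pos : 0 < LW := by decide

/-- Reading an arbitrary bit of a lane vector. [this work] -/
theorem testBit_ofLanes' {nb : ℕ} {f : ℕ → ℕ} (hf : ∀ i < nb, f i < 2 ^ LW) (p : ℕ) :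
    (ofLanes nb f).testBit p = (decide (p / LW < nb) && (f (p / LW)).testBit (p % LW)) := by
  conv_lhs => rw [← Nat.div_add_mod p LW]
  exact testBit_ofLanes hf _ _ (Nat.mod_lt _ LW_pos)

/-- **Reading a lane back.** [this work] -/
theorem laneOf_ofLanes {nb : ℕ} {f : ℕ → ℕ} (hf : ∀ i < nb, f i < 2 ^ LW) {i : ℕ} (hi : i < nb) :
    laneOf (ofLanes nb f) i = f i := by
  unfold laneOf
  apply Nat.eq_of_testBit_eq
  intro j
  rw [Nat.testBit_mod_two_pow, Nat.testBit_shiftRight, testBit_ofLanes' hf]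
  by_cases hj : j < LW
  · have h1 : (LW * i + j) / LW = i := by
      rw [Nat.add_comm, Nat.add_mul_div_left _ _ LW_pos, Nat.div_eq_of_lt hj, Nat.zero_add]
    have h2 : (LW * i + j) % LW = j := by rw [Nat.add_comm, Nat.add_mul_mod_self_left, Nat.mod_eq_of_lt hj]
    rw [h1, h2]; simp [hj, hi]
  · have : (f i).testBit j = false :=
      Nat.testBit_lt_two_pow (lt_of_lt_of_le (hf i hi) (Nat.pow_le_pow_right (by omega) (Nat.le_of_not_lt hj)))
    rw [this]; simp [hj]

/-- Two lane vectors with equal readable lanes are equal. [this work] -/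
theorem eq_of_testBit_lanes {x : ℕ} {nb : ℕ} {g : ℕ → ℕ} (hg : ∀ i < nb, g i < 2 ^ LW)
    (h : ∀ p, x.testBit p = (decide (p / LW < nb) && (g (p / LW)).testBit (p % LW))) : x = ofLanes nb g :=
  Nat.eq_of_testBit_eq fun p => by rw [h p, testBit_ofLanes' hg]

/-! ### Arithmetic and bitwise operations act lane by lane -/

/-- Addition. [this work] -/
theorem ofLanes_add (nb : ℕ) (f g : ℕ → ℕ) : ofLanes nb f + ofLanes nb g = ofLanes nb (fun i => f i + g i) := by
  unfold ofLanes; rw [← Finset.sum_add_distrib]; exact Finset.sum_congr rfl fun i _ => by ring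

/-- Subtraction without borrows. [this work] -/
theorem ofLanes_sub {nb : ℕ} {f g : ℕ → ℕ} (h : ∀ i < nb, g i ≤ f i) :
    ofLanes nb f - ofLanes nb g = ofLanes nb (fun i => f i - g i) := by
  have : ofLanes nb (fun i => f i - g i) + ofLanes nb g = ofLanes nb f := by
    rw [ofLanes_add]; exact ofLanes_congr fun i hi => Nat.sub_add_cancel (h i hi)
  omega

/-- Multiplication by a constant. [this work] -/
theorem ofLanes_mul (nb : ℕ) (f : ℕ → ℕ) (c : ℕ) : ofLanes nb f * c = ofLanes nb (fun i => f i * c) := by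
  unfold ofLanes; rw [Finset.sum_mul]; exact Finset.sum_congr rfl fun i _ => by ring

/-- Left shift. [this work] -/
theorem ofLanes_shiftLeft (nb : ℕ) (f : ℕ → ℕ) (k : ℕ) : ofLanes nb f <<< k = ofLanes nb (fun i => f i * 2 ^ k) := by
  rw [Nat.shiftLeft_eq, ofLanes_mul]

/-- Bitwise AND. [this work] -/
theorem ofLanes_and {nb : ℕ} {f g : ℕ → ℕ} (hf : ∀ i < nb, f i < 2 ^ LW) (hg : ∀ i < nb, g i < 2 ^ LW) :
    ofLanes nb f &&& ofLanes nb g = ofLanes nb (fun i => f i &&& g i) := by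
  refine eq_of_testBit_lanes (fun i hi => Nat.and_lt_two_pow _ (hg i hi)) fun p => ?_
  rw [Nat.testBit_and, testBit_ofLanes' hf, testBit_ofLanes' hg, Nat.testBit_and]
  cases decide (p / LW < nb) <;> simp

/-- Bitwise OR. [this work] -/
theorem ofLanes_or {nb : ℕ} {f g : ℕ → ℕ} (hf : ∀ i < nb, f i < 2 ^ LW) (hg : ∀ i < nb, g i < 2 ^ LW) :
    ofLanes nb f ||| ofLanes nb g = ofLanes nb (fun i => f i ||| g i) := by
  refine eq_of_testBit_lanes (fun i hi => Nat.or_lt_two_pow (hf i hi) (hg i hi)) fun p => ?_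
  rw [Nat.testBit_or, testBit_ofLanes' hf, testBit_ofLanes' hg, Nat.testBit_or]
  cases decide (p / LW < nb) <;> simp

/-- Bitwise XOR. [this work] -/
theorem ofLanes_xor {nb : ℕ} {f g : ℕ → ℕ} (hf : ∀ i < nb, f i < 2 ^ LW) (hg : ∀ i < nb, g i < 2 ^ LW) :
    ofLanes nb f ^^^ ofLanes nb g = ofLanes nb (fun i => f i ^^^ g i) := by
  refine eq_of_testBit_lanes (fun i hi => Nat.xor_lt_two_pow (hf i hi) (hg i hi)) fun p => ?_
  rw [Nat.testBit_xor, testBit_ofLanes' hf, testBit_ofLanes' hg, Nat.testBit_xor]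
  cases decide (p / LW < nb) <;> simp

/-! ### `foldBelow` sums, `ones`, bit extraction -/

/-- A `foldBelow` accumulation is a sum over `range`. [this work] -/
theorem foldBelow_add_eq_sum (n : ℕ) (h : ℕ → ℕ) : foldBelow n (fun i acc => acc + h i) 0 = ∑ i ∈ range n, h i := by
  induction n with
  | zero => rfl
  | succ n ih => show foldBelow n _ 0 + h n = _; rw [ih, Finset.sum_range_succ]

/-- **`ones nb` is the lane vector with every lane `1`.** [this work] -/
theorem ones_eq (nb : ℕ) : ones nb = ofLanes nb (fun _ => 1) := by
  unfold ones ofLanes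
  rw [foldBelow_add_eq_sum]
  exact Finset.sum_congr rfl fun i _ => by rw [Nat.one_shiftLeft, Nat.one_mul]

/-- Lanes equal to one are `< 2^LW`. [this work] -/
theorem one_lt_two_pow_LW : (1 : ℕ) < 2 ^ LW := by decide

/-- The indicator `[b]` as a natural number. [this work] -/
def bit01 (b : Bool) : ℕ := if b then 1 else 0

/-- `bit01 b ≤ 1`. [this work] -/
theorem bit01_le (b : Bool) : bit01 b ≤ 1 := by cases b <;> simp [bit01]

/-- Bits of `bit01 b`. [this work] -/
theorem testBit_bit01 (b : Bool) (j : ℕ) : (bit01 b).testBit j = (b && decide (j = 0)) := by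
  cases b
  · simp [bit01]
  · cases j with
    | zero => simp [bit01]
    | succ j => simp [bit01, Nat.testBit_add_one]

/-- **Bit extraction**: shifting a lane vector right by `x < LW` and masking with `ones` reads bit `x` of every lane
(lanes `< 2^(LW - x)`... here: lanes `< 2^LW` and bit positions `x + (LW·(i+1) ..)` of the NEXT lane never reach bit `0`, which
is automatic since we only keep bit `0` of each lane). [this work] -/
theorem extract_eq {nb : ℕ} {f : ℕ → ℕ} (hf : ∀ i < nb, f i < 2 ^ LW) {x : ℕ} (hx : x < LW) :
    (ofLanes nb f >>> x) &&& ones nb = ofLanes nb (fun i => bit01 ((f i).testBit x)) := by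
  have hb : ∀ i < nb, bit01 ((f i).testBit x) < 2 ^ LW := fun i _ => lt_of_le_of_lt (bit01_le _) one_lt_two_pow_LW
  refine eq_of_testBit_lanes hb fun p => ?_
  rw [ones_eq, Nat.testBit_and, Nat.testBit_shiftRight, testBit_ofLanes' (fun _ _ => one_lt_two_pow_LW), testBit_bit01]
  by_cases hnb : p / LW < nb
  · simp only [hnb, decide_true, Bool.true_and]
    by_cases hp0 : p % LW = 0
    · -- bit 0 of lane p/LW: position x + p reads bit x of lane p / LW
      have hp : p = LW * (p / LW) := by have := Nat.div_add_mod p LW; omega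
      have h1 : (x + p) = LW * (p / LW) + x := by omega
      rw [h1, testBit_ofLanes hf _ _ hx]
      simp [hnb, hp0]
    · have : (1 : ℕ).testBit (p % LW) = false := by
        cases h : p % LW with
        | zero => exact absurd h hp0
        | succ k => simp [Nat.testBit_add_one]
      rw [this]; simp [hp0]
  · simp [hnb]

/-! ### Saturating subtraction and minimum -/

/-- `GB < LW` and the room above the guard bit. [this work] -/
theorem GB_lt_LW : GB + 1 ≤ LW := by decide

/-- `FMUL = 2^GB - 1`. [this work] -/
theorem FMUL_eq : FMUL = 2 ^ GB - 1 := rfl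

/-- The guard bit of `f + 2^GB - g` records `g ≤ f` (both `< 2^GB`). [this work] -/
theorem testBit_guard {f g : ℕ} (hf : f < 2 ^ GB) (hg : g < 2 ^ GB) : (f + 2 ^ GB - g).testBit GB = decide (g ≤ f) := by
  by_cases h : g ≤ f
  · have e : f + 2 ^ GB - g = 2 ^ GB + (f - g) := by omega
    rw [e, Nat.testBit_two_pow_add_eq, Nat.testBit_lt_two_pow (lt_of_le_of_lt (Nat.sub_le f g) hf)]
    simp [h]
  · have hlt : f + 2 ^ GB - g < 2 ^ GB := by omega
    rw [Nat.testBit_lt_two_pow hlt]; simp [h]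

/-- Masking `f + 2^GB - g` with the low `GB` bits gives `f - g` when `g ≤ f`. [this work] -/
theorem guard_and_FMUL {f g : ℕ} (hf : f < 2 ^ GB) (h : g ≤ f) : FMUL &&& (f + 2 ^ GB - g) = f - g := by
  have e : f + 2 ^ GB - g = 2 ^ GB + (f - g) := by omega
  rw [e, Nat.land_comm, FMUL_eq, Nat.and_two_pow_sub_one_eq_mod, Nat.add_mod_left,
    Nat.mod_eq_of_lt (lt_of_le_of_lt (Nat.sub_le f g) hf)]

/-- **`satsub` is lane-wise truncated subtraction** (all lanes `< 2^GB`). [this work] -/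
theorem satsub_eq {nb : ℕ} {f g : ℕ → ℕ} (hf : ∀ i < nb, f i < 2 ^ GB) (hg : ∀ i < nb, g i < 2 ^ GB) :
    satsub (ones nb) (ones nb <<< GB) (ofLanes nb f) (ofLanes nb g) = ofLanes nb (fun i => f i - g i) := by
  have hGB : (2 : ℕ) ^ GB < 2 ^ LW := Nat.pow_lt_pow_right (by omega) (by decide)
  have hGB1 : (2 : ℕ) ^ (GB + 1) ≤ 2 ^ LW := Nat.pow_le_pow_right (by omega) GB_lt_LW
  have hfL : ∀ i < nb, f i < 2 ^ LW := fun i hi => (hf i hi).trans hGB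
  -- the three intermediate lane vectors
  have hd : ofLanes nb f + (ones nb <<< GB) - ofLanes nb g = ofLanes nb (fun i => f i + 2 ^ GB - g i) := by
    rw [ones_eq, ofLanes_shiftLeft, ofLanes_add, ofLanes_sub (fun i hi => ?_)]
    · rfl
    · have := hg i hi; omega
  have hdb : ∀ i < nb, f i + 2 ^ GB - g i < 2 ^ LW := fun i hi => by
    have := hf i hi; have h2 : 2 ^ GB + 2 ^ GB = 2 ^ (GB + 1) := by rw [Nat.pow_succ]; omega
    omega
  have he : ((ofLanes nb (fun i => f i + 2 ^ GB - g i) >>> GB) &&& ones nb) =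
      ofLanes nb (fun i => bit01 (decide (g i ≤ f i))) := by
    rw [extract_eq hdb (by decide : GB < LW)]
    exact ofLanes_congr fun i hi => by rw [testBit_guard (hf i hi) (hg i hi)]
  have hm : ofLanes nb (fun i => bit01 (decide (g i ≤ f i))) * FMUL = ofLanes nb (fun i => bit01 (decide (g i ≤ f i)) * FMUL) :=
    ofLanes_mul _ _ _
  have hmb : ∀ i < nb, bit01 (decide (g i ≤ f i)) * FMUL < 2 ^ LW := fun i _ => by
    have : bit01 (decide (g i ≤ f i)) * FMUL ≤ 1 * FMUL := Nat.mul_le_mul_right _ (bit01_le _)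
    have h2 : FMUL < 2 ^ GB := by rw [FMUL_eq]; exact Nat.sub_lt Nat.one_le_two_pow Nat.one_pos
    omega
  unfold satsub
  simp only []
  rw [hd, he, hm, ofLanes_and hmb hdb]
  refine ofLanes_congr fun i hi => ?_
  by_cases h : g i ≤ f i
  · have hb : bit01 (decide (g i ≤ f i)) = 1 := by simp [bit01, h]
    rw [hb, Nat.one_mul]
    exact guard_and_FMUL (hf i hi) h
  · have hb : bit01 (decide (g i ≤ f i)) = 0 := by simp [bit01, h]
    rw [hb, Nat.zero_mul, Nat.zero_and]
    omega

/-- **`lmin` is the lane-wise minimum** (all lanes `< 2^GB`). [this work] -/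
theorem lmin_eq {nb : ℕ} {f g : ℕ → ℕ} (hf : ∀ i < nb, f i < 2 ^ GB) (hg : ∀ i < nb, g i < 2 ^ GB) :
    lmin (ones nb) (ones nb <<< GB) (ofLanes nb f) (ofLanes nb g) = ofLanes nb (fun i => min (f i) (g i)) := by
  unfold lmin
  rw [satsub_eq hf hg, ofLanes_sub (fun i _ => Nat.sub_le _ _)]
  exact ofLanes_congr fun i _ => by omega

end Summit.CriticalPhenomena.PercolationContinuityZ3.Theorems.SahiGridPattern.Pair43
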